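import Summits.Langlands.Langlands.Theses.CMFreeCompletedClosure
import Literature.Algebra.Homology.GroupCohomologySemilinear

/-!
# `CMFreeCompletedClosure.Visibility` — typed decompositions with PROVED seams (crux-strategist)

Crux `Summit.Langlands.Langlands.Theses.CMFreeCompletedClosure.Visibility` (stmt-Langlands-18470; shared
with route `ParityFreeBigHecke`).  Sorry-free.  Nothing of the route is asserted; this file proves:

* `smul_groupCohomology_eq_zero` (**torsion glue**, Mathlib only): if a scalar `r : k` kills the
  coefficient representation `A`, it kills every class of `Hⁿ(G, A)` (lift to a cocycle, which is a
  function with values in `A`).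
* `occurs_of_congruences` — the registered stub `stub_occurs_of_congruences` of the birth skeleton
  (`Lines/birth.lean` of this crux) **proved outright**: an `𝒪`-valued spherical eigensystem `a` of
  tame level `𝒰` that is, for every `t`, congruent mod `ℓ^{t+1}` to SOME eigensystem `b_t` occurring in
  `H̃^i(𝒰)` (`TameLevel.EigensystemOccurs`, torsion classes allowed) occurs itself: the stage-`t`
  eigenclass of `b_t` in `H^i(X_{U_r}, 𝒪/ℓ^{t+1})` is killed by `ℓ^{t+1}`, so `(a - b_t) • c = 0` and the
  same class `c` (same exact annihilator) is an eigenclass for `a`.  Hence the set of occurring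
  eigensystems in a fixed degree is `ℓ`-adically closed.
* the **regime seam** `Visibility_of_regular_irregular :
  VisibilityRegular → IrregularLimit → Visibility` (the two remaining birth stubs, verbatim, imply the
  crux — `stub_occurs_of_congruences` is no longer needed), and
* the **two-axis seam** `Visibility_of_subs :
  VisibilityRegular → IntegralFamilyIrregular → OccursOfFamilyIrregular → Visibility`, separating, on
  the irregular (non-cohomological) sector, the ARITHMETIC content of the crux (an `ℓ`-integral
  arithmetic-Frobenius Satake family exists for every `ι` — for `n = 2` over an imaginary quadratic
  field this already contains the algebraicity of the Hecke eigenvalues of Maass forms of eigenvalue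
  `1/4`, by quadratic base change) from its COHOMOLOGICAL content (such a family, once integral, is an
  `ℓ`-adic limit of eigensystems occurring in completed cohomology at a tame level containing the
  exceptional set), plus the finer four-piece seam `Visibility_of_four` that cuts the regular sector the
  same way (`IntegralFamilyRegular`: Clozel + integrality of cuspidal cohomology; `OccursOfFamilyRegular`:
  Franke–Borel realisation + Emerton/Hochschild–Serre weight independence).

The sub-statements are `def`s here so that the seams are kernel-checked implications between named
propositions; their texts are the child statements of `children.json` / the stubs of
`Lines/integral_family_split.lean`.
-/

noncomputable section

set_option linter.dupNamespace false

open CategoryTheory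
open scoped NumberField

namespace Summit.Langlands.Langlands.Cruxes.Visibility.StrategySplit

open Literature.NumberTheory.Automorphic IsDedekindDomain

universe u

/-! ## Torsion glue: a scalar killing the coefficients kills group cohomology -/

section Torsion

variable {k : Type u} [CommRing k] {G : Type u} [Group G]

/-- If `r • a = 0` for every `a : A`, then `r • x = 0` for every `x ∈ Hⁿ(G, A)` (lift `x` to a cocycle
`z`, a function `Gⁿ → A`, on which `r` acts valuewise). [folklore] -/
theorem smul_groupCohomology_eq_zero (A : Rep k G) (n : ℕ) {r : k} (hr : ∀ a : A, r • a = 0)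
    (x : groupCohomology A n) : r • x = 0 := by
  obtain ⟨z, rfl⟩ := Literature.Algebra.Homology.π_surjective A n x
  have hz : r • z = 0 := by
    apply Literature.Algebra.Homology.iCocycles_injective A n
    rw [map_smul, map_zero]
    funext g
    exact hr _
  rw [← map_smul, hz, map_zero]

/-- A scalar in `I` kills `k ⧸ I`. [folklore] -/
theorem smul_quotient_eq_zero_of_mem {I : Ideal k} {r : k} (hr : r ∈ I) (m : k ⧸ I) : r • m = 0 := by
  rw [Algebra.smul_def, Ideal.Quotient.algebraMap_eq, Ideal.Quotient.eq_zero_iff_mem.mpr hr, zero_mul]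

/-- A scalar in `(ϖ^t)` kills `H^i(X_L, k/ϖ^t)` (cohomology of an arithmetic quotient with
`ϖ^t`-torsion coefficients). [folklore] -/
theorem smul_cohomology_modPow_eq_zero {Γ 𝒢 : Type u} [Group Γ] [Group 𝒢] (ι : Γ →* 𝒢)
    (L : Subgroup 𝒢) (ϖ : k) (t i : ℕ) {r : k} (hr : r ∈ Ideal.span {ϖ ^ t})
    (x : ArithmeticQuotient.cohomology k ι L (modPow k ϖ t) i) : r • x = 0 := by
  refine smul_groupCohomology_eq_zero (ArithmeticQuotient.coeffRep k ι L (modPow k ϖ t)) i ?_ x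
  intro f
  funext c
  exact smul_quotient_eq_zero_of_mem hr (f c)

end Torsion

/-! ## The closure stub of the birth skeleton, proved -/

/-- **`stub_occurs_of_congruences` (birth skeleton of `Visibility`), proved.**  If for every `t` some
eigensystem `b` occurring in `H̃^i` at tame level `𝒰` satisfies `a ≡ b (mod ℓ^{t+1})` valuewise, then
`a` occurs in `H̃^i` at tame level `𝒰`: the stage-`t` eigenclass of `b` is an eigenclass for `a`
(`smul_cohomology_modPow_eq_zero`). [folklore] -/
theorem occurs_of_congruences : ∀ (E : Type) [Field E] [NumberField E] (n ℓ : ℕ) [Fact ℓ.Prime] (𝒰 : Literature.NumberTheory.Automorphic.BigHeckeGLn.TameLevel n E ℓ) (i : ℕ) (a : IsDedekindDomain.HeightOneSpectrum (NumberField.RingOfIntegers E) → ℕ → (Valued.v : Valuation (PadicAlgCl ℓ) NNReal).valuationSubring), (∀ t : ℕ, ∃ b : IsDedekindDomain.HeightOneSpectrum (NumberField.RingOfIntegers E) → ℕ → (Valued.v : Valuation (PadicAlgCl ℓ) NNReal).valuationSubring, 𝒰.EigensystemOccurs (Valued.v : Valuation (PadicAlgCl ℓ) NNReal).valuationSubring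 b i ∧ ∀ (v : IsDedekindDomain.HeightOneSpectrum (NumberField.RingOfIntegers E)) (j : ℕ), a v j - b v j ∈ Ideal.span {(((ℓ : ℕ) : (Valued.v : Valuation (PadicAlgCl ℓ) NNReal).valuationSubring)) ^ (t + 1)}) → 𝒰.EigensystemOccurs (Valued.v : Valuation (PadicAlgCl ℓ) NNReal).valuationSubring a i := by
  intro E _ _ n ℓ _ 𝒰 i a h t
  obtain ⟨b, hb, hab⟩ := h t
  obtain ⟨s, c, ⟨hc0, hceig⟩, hann⟩ := hb t
  refine ⟨s, c, ⟨hc0, fun x => ?_⟩, hann⟩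
  rw [hceig x]
  have hzero := smul_cohomology_modPow_eq_zero (BigHeckeGLn.globalEmbedding n E) (𝒰.tower s)
    (((ℓ : ℕ) : (Valued.v : Valuation (PadicAlgCl ℓ) NNReal).valuationSubring)) (t + 1) i
    (hab x.v x.i) c
  rw [sub_smul, sub_eq_zero] at hzero
  exact hzero.symm

/-! ## The sub-statements -/

/-- **Sub₁ = `VisibilityRegular`** (verbatim the registered stub `stub_visibility_regular` (skeleton bf45fa88)): `Visibility` for
REGULAR L-algebraic cuspidal `π` — cohomological after the C-twist `π^∨ ⊗ |det|^{(n-1)/2}`; Franke /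
Borel–Clozel realisation in `H^•(X_K, V_λ)` plus Emerton's weight independence of completed cohomology.
Known in print in the `IsHeckePoint` form; the eigenclass-with-exact-annihilator form is the formal
content. -/
def VisibilityRegular : Prop :=
  ∀ (E : Type) [Field E] [NumberField E], NumberField.IsTotallyComplex E → ∀ (n : ℕ), 0 < n → ∀ (hcpt : Literature.NumberTheory.Automorphic.isCompact_glFiniteIntegralLevel n E) (π : Literature.NumberTheory.Automorphic.CuspidalAutomorphicRepData n E hcpt), π.1.IsLAlgebraic → (∃ T : Literature.NumberTheory.Automorphic.InfinityType E n, π.1.HasInfinityType T ∧ T.IsLAlgebraic ∧ T.IsRegular) → ∀ (ℓ : ℕ) [Fact ℓ.Prime] (ι : PadicAlgCl ℓ ≃+* ℂ), ∃ (𝒰 : Literature.NumberTheory.Automorphic.BigHeckeGLn.TameLevel n E ℓ) (i : ℕ) (a : IsDedekindDomain.HeightOneSpectrum (NumberField.RingOfIntegers E) → ℕ → (Valued.v : Valuation (PadicAlgCl ℓ) NNReal).valuationSubring), 𝒰.EigensystemOccurs (Valued.v : Valuation (PadicAlgCl ℓ) NNReal).valuationSubring a i ∧ ∀ v ∉ 𝒰.bad,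 ∃ α : Multiset ℂ, π.1.HasSatakeParamAt v α ∧ Literature.NumberTheory.Automorphic.BigHeckeGLn.heckeFrobPoly n (Ideal.absNorm v.asIdeal) (fun j => ((a v j : (Valued.v : Valuation (PadicAlgCl ℓ) NNReal).valuationSubring) : PadicAlgCl ℓ)) = Literature.NumberTheory.Automorphic.arithFrobPolyOfSatake ι v.residueCard 1 α

/-- **`IrregularLimit`** (verbatim the registered stub `stub_irregular_congruences` (skeleton bf45fa88)): for IRREGULAR
L-algebraic cuspidal `π`, an `𝒪`-valued arithmetic Satake family at some tame level which is, mod every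
`ℓ^{t+1}`, congruent to an occurring eigensystem.  The open core of the crux in regime form. -/
def IrregularLimit : Prop :=
  ∀ (E : Type) [Field E] [NumberField E], NumberField.IsTotallyComplex E → ∀ (n : ℕ), 0 < n → ∀ (hcpt : Literature.NumberTheory.Automorphic.isCompact_glFiniteIntegralLevel n E) (π : Literature.NumberTheory.Automorphic.CuspidalAutomorphicRepData n E hcpt), π.1.IsLAlgebraic → ¬ (∃ T : Literature.NumberTheory.Automorphic.InfinityType E n, π.1.HasInfinityType T ∧ T.IsLAlgebraic ∧ T.IsRegular) → ∀ (ℓ : ℕ) [Fact ℓ.Prime] (ι : PadicAlgCl ℓ ≃+* ℂ), ∃ (𝒰 : Literature.NumberTheory.Automorphic.BigHeckeGLn.TameLevel n E ℓ) (i : ℕ) (a : IsDedekindDomain.HeightOneSpectrum (NumberField.RingOfIntegers E) → ℕ → (Valued.v : Valuation (PadicAlgCl ℓ) NNReal).valuationSubring), (∀ v ∉ 𝒰.bad, ∃ α : Multiset ℂ, π.1.HasSatakeParamAt v α ∧ Literature.NumberTheory.Automorphic.BigHeckeGLn.heckeFrobPoly n (Ideal.absNorm v.asIdeal) (fun j =>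 ((a v j : (Valued.v : Valuation (PadicAlgCl ℓ) NNReal).valuationSubring) : PadicAlgCl ℓ)) = Literature.NumberTheory.Automorphic.arithFrobPolyOfSatake ι v.residueCard 1 α) ∧ ∀ t : ℕ, ∃ b : IsDedekindDomain.HeightOneSpectrum (NumberField.RingOfIntegers E) → ℕ → (Valued.v : Valuation (PadicAlgCl ℓ) NNReal).valuationSubring, 𝒰.EigensystemOccurs (Valued.v : Valuation (PadicAlgCl ℓ) NNReal).valuationSubring b i ∧ ∀ (v : IsDedekindDomain.HeightOneSpectrum (NumberField.RingOfIntegers E)) (j : ℕ), a v j - b v j ∈ Ideal.span {(((ℓ : ℕ) : (Valued.v : Valuation (PadicAlgCl ℓ) NNReal).valuationSubring)) ^ (t + 1)}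

/-- **Sub₂ = `IntegralFamilyIrregular`** (arithmetic axis): for IRREGULAR L-algebraic cuspidal `π` and
every `ℓ`, `ι` there are a finite exceptional set `S` and an `𝒪_{ℚ̄_ℓ}`-valued family `a` whose Hecke
polynomial at every `v ∉ S` is the arithmetic-Frobenius Satake polynomial of `π_v` — i.e. the normalised
Hecke eigenvalues `q_v^{-j(j-1)/2} e_j(α_v⁻¹)` are `ℓ`-integral under `ι⁻¹`.  Over all `ι` this is the
algebraic INTEGRALITY of the Satake polynomials of `π` off a finite set; for `n = 2`, `E` imaginary
quadratic it contains (quadratic base change) the algebraicity of Hecke eigenvalues of Maass forms of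
eigenvalue `1/4` — open (Scholze 2015 §1; Calegari ICM 2022 §12). No cohomology in the statement. -/
def IntegralFamilyIrregular : Prop :=
  ∀ (E : Type) [Field E] [NumberField E], NumberField.IsTotallyComplex E → ∀ (n : ℕ), 0 < n → ∀ (hcpt : Literature.NumberTheory.Automorphic.isCompact_glFiniteIntegralLevel n E) (π : Literature.NumberTheory.Automorphic.CuspidalAutomorphicRepData n E hcpt), π.1.IsLAlgebraic → ¬ (∃ T : Literature.NumberTheory.Automorphic.InfinityType E n, π.1.HasInfinityType T ∧ T.IsLAlgebraic ∧ T.IsRegular) → ∀ (ℓ : ℕ) [Fact ℓ.Prime] (ι : PadicAlgCl ℓ ≃+* ℂ), ∃ (S : Finset (IsDedekindDomain.HeightOneSpectrum (NumberField.RingOfIntegers E))) (a : IsDedekindDomain.HeightOneSpectrum (NumberField.RingOfIntegers E) → ℕ → (Valued.v : Valuation (PadicAlgCl ℓ) NNReal).valuationSubring), ∀ v ∉ S, ∃ α : Multiset ℂ, π.1.HasSatakeParamAt v α ∧ Literature.NumberTheory.Automorphic.BigHeckeGLn.heckeFrobPoly n (Ideal.absNorm v.asIdeal) (fun j => ((a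 v j : (Valued.v : Valuation (PadicAlgCl ℓ) NNReal).valuationSubring) : PadicAlgCl ℓ)) = Literature.NumberTheory.Automorphic.arithFrobPolyOfSatake ι v.residueCard 1 α

/-- **Sub₃ = `OccursOfFamilyIrregular`** (cohomological axis): for IRREGULAR L-algebraic cuspidal `π`,
every `ℓ`-integral arithmetic Satake family `a` of `π` off a finite `S` is, at some tame level `𝒰` with
`𝒰.bad ⊇ S` and in some degree `i`, an `ℓ`-adic limit of eigensystems occurring in `H̃^i(𝒰)` (torsion
classes allowed — NOT asked to be classical, cf. Calegari–Mazur).  The Calegari–Emerton "completed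
cohomology sees every automorphic Galois representation" expectation, for integral data. -/
def OccursOfFamilyIrregular : Prop :=
  ∀ (E : Type) [Field E] [NumberField E], NumberField.IsTotallyComplex E → ∀ (n : ℕ), 0 < n → ∀ (hcpt : Literature.NumberTheory.Automorphic.isCompact_glFiniteIntegralLevel n E) (π : Literature.NumberTheory.Automorphic.CuspidalAutomorphicRepData n E hcpt), π.1.IsLAlgebraic → ¬ (∃ T : Literature.NumberTheory.Automorphic.InfinityType E n, π.1.HasInfinityType T ∧ T.IsLAlgebraic ∧ T.IsRegular) → ∀ (ℓ : ℕ) [Fact ℓ.Prime] (ι : PadicAlgCl ℓ ≃+* ℂ) (S : Finset (IsDedekindDomain.HeightOneSpectrum (NumberField.RingOfIntegers E))) (a : IsDedekindDomain.HeightOneSpectrum (NumberField.RingOfIntegers E) → ℕ → (Valued.v : Valuation (PadicAlgCl ℓ) NNReal).valuationSubring), (∀ v ∉ S, ∃ α : Multiset ℂ, π.1.HasSatakeParamAt v α ∧ Literature.NumberTheory.Automorphic.BigHeckeGLn.heckeFrobPoly n (Ideal.absNorm v.asIdeal) (fun j => ((a v j : (Valued.v : Valuation (PadicAlgCl ℓ)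 NNReal).valuationSubring) : PadicAlgCl ℓ)) = Literature.NumberTheory.Automorphic.arithFrobPolyOfSatake ι v.residueCard 1 α) → ∃ (𝒰 : Literature.NumberTheory.Automorphic.BigHeckeGLn.TameLevel n E ℓ) (i : ℕ), (∀ v ∈ S, v ∈ 𝒰.bad) ∧ ∀ t : ℕ, ∃ b : IsDedekindDomain.HeightOneSpectrum (NumberField.RingOfIntegers E) → ℕ → (Valued.v : Valuation (PadicAlgCl ℓ) NNReal).valuationSubring, 𝒰.EigensystemOccurs (Valued.v : Valuation (PadicAlgCl ℓ) NNReal).valuationSubring b i ∧ ∀ (v : IsDedekindDomain.HeightOneSpectrum (NumberField.RingOfIntegers E)) (j : ℕ), a v j - b v j ∈ Ideal.span {(((ℓ : ℕ) : (Valued.v : Valuation (PadicAlgCl ℓ) NNReal).valuationSubring)) ^ (t + 1)}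

/-- **`IntegralFamilyRegular`**: Sub₂ for REGULAR `π` — known in print: `ℚ(π_f)` is a number field
(Clozel 1990, Thm. 3.13) and the `T_{v,j}`-eigenvalues of the cohomological twist are algebraic
integers (they preserve the image of integral cuspidal cohomology), hence `ℓ`-integral under every `ι`. -/
def IntegralFamilyRegular : Prop :=
  ∀ (E : Type) [Field E] [NumberField E], NumberField.IsTotallyComplex E → ∀ (n : ℕ), 0 < n → ∀ (hcpt : Literature.NumberTheory.Automorphic.isCompact_glFiniteIntegralLevel n E) (π : Literature.NumberTheory.Automorphic.CuspidalAutomorphicRepData n E hcpt), π.1.IsLAlgebraic → (∃ T : Literature.NumberTheory.Automorphic.InfinityType E n, π.1.HasInfinityType T ∧ T.IsLAlgebraic ∧ T.IsRegular) → ∀ (ℓ : ℕ) [Fact ℓ.Prime] (ι : PadicAlgCl ℓ ≃+* ℂ), ∃ (S : Finset (IsDedekindDomain.HeightOneSpectrum (NumberField.RingOfIntegers E))) (a : IsDedekindDomain.HeightOneSpectrum (NumberField.RingOfIntegers E) → ℕ → (Valued.v : Valuation (PadicAlgCl ℓ) NNReal).valuationSubring), ∀ v ∉ S, ∃ α : Multiset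 ℂ, π.1.HasSatakeParamAt v α ∧ Literature.NumberTheory.Automorphic.BigHeckeGLn.heckeFrobPoly n (Ideal.absNorm v.asIdeal) (fun j => ((a v j : (Valued.v : Valuation (PadicAlgCl ℓ) NNReal).valuationSubring) : PadicAlgCl ℓ)) = Literature.NumberTheory.Automorphic.arithFrobPolyOfSatake ι v.residueCard 1 α

/-- **`OccursOfFamilyRegular`**: Sub₃ for REGULAR `π`, in direct form — an integral arithmetic Satake
family of a regular `π` off `S` occurs (`EigensystemOccurs`) at some tame level `𝒰 ⊇ S` in some degree:
Franke / Borel realisation of `π^∨ ⊗ |det|^{(n-1)/2}` in `H^•(X_K, V_λ)` and Emerton / Hochschild–Serre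
passage to trivial `ℓ^{t+1}`-torsion coefficients at deep level (uniqueness of `a` off `S`: the Hecke
polynomial determines `a v j`, `1 ≤ j ≤ n`). -/
def OccursOfFamilyRegular : Prop :=
  ∀ (E : Type) [Field E] [NumberField E], NumberField.IsTotallyComplex E → ∀ (n : ℕ), 0 < n → ∀ (hcpt : Literature.NumberTheory.Automorphic.isCompact_glFiniteIntegralLevel n E) (π : Literature.NumberTheory.Automorphic.CuspidalAutomorphicRepData n E hcpt), π.1.IsLAlgebraic → (∃ T : Literature.NumberTheory.Automorphic.InfinityType E n, π.1.HasInfinityType T ∧ T.IsLAlgebraic ∧ T.IsRegular) → ∀ (ℓ : ℕ) [Fact ℓ.Prime] (ι : PadicAlgCl ℓ ≃+* ℂ) (S : Finset (IsDedekindDomain.HeightOneSpectrum (NumberField.RingOfIntegers E))) (a : IsDedekindDomain.HeightOneSpectrum (NumberField.RingOfIntegers E) → ℕ → (Valued.v : Valuation (PadicAlgCl ℓ) NNReal).valuationSubring), (∀ v ∉ S, ∃ α : Multiset ℂ, π.1.HasSatakeParamAt v α ∧ Literature.NumberTheory.Automorphic.BigHeckeGLn.heckeFrobPoly n (Ideal.absNorm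 v.asIdeal) (fun j => ((a v j : (Valued.v : Valuation (PadicAlgCl ℓ) NNReal).valuationSubring) : PadicAlgCl ℓ)) = Literature.NumberTheory.Automorphic.arithFrobPolyOfSatake ι v.residueCard 1 α) → ∃ (𝒰 : Literature.NumberTheory.Automorphic.BigHeckeGLn.TameLevel n E ℓ) (i : ℕ), (∀ v ∈ S, v ∈ 𝒰.bad) ∧ 𝒰.EigensystemOccurs (Valued.v : Valuation (PadicAlgCl ℓ) NNReal).valuationSubring a i

/-! ## The seams -/

/-- **Regime seam**: the two non-trivial birth stubs already give the crux
(`occurs_of_congruences` discharges the third). -/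
theorem Visibility_of_regular_irregular :
    VisibilityRegular → IrregularLimit →
      Summit.Langlands.Langlands.Theses.CMFreeCompletedClosure.Visibility := by
  intro h1 h2 E _ _ hE n hn hcpt π hπ ℓ _ ι
  by_cases hreg : (∃ T : Literature.NumberTheory.Automorphic.InfinityType E n, π.1.HasInfinityType T ∧ T.IsLAlgebraic ∧ T.IsRegular)
  · exact h1 E hE n hn hcpt π hπ hreg ℓ ι
  · obtain ⟨𝒰, i, a, hsat, hlim⟩ := h2 E hE n hn hcpt π hπ hreg ℓ ι
    exact ⟨𝒰, i, a, occurs_of_congruences E n ℓ 𝒰 i a hlim, hsat⟩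

/-- **Two-axis seam** (the filed decomposition): `Sub₁ → Sub₂ → Sub₃ → Visibility`. On the irregular
sector, Sub₂ supplies the integral family `(S, a)`, Sub₃ a tame level `𝒰 ⊇ S`, a degree and the
congruences, `occurs_of_congruences` the occurrence; the Satake identity off `𝒰.bad ⊇ S` is Sub₂'s. -/
theorem Visibility_of_subs :
    VisibilityRegular → IntegralFamilyIrregular → OccursOfFamilyIrregular →
      Summit.Langlands.Langlands.Theses.CMFreeCompletedClosure.Visibility := by
  intro h1 h2 h3 E _ _ hE n hn hcpt π hπ ℓ _ ι
  by_cases hreg : (∃ T : Literature.NumberTheory.Automorphic.InfinityType E n, π.1.HasInfinityType T ∧ T.IsLAlgebraic ∧ T.IsRegular)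
  · exact h1 E hE n hn hcpt π hπ hreg ℓ ι
  · obtain ⟨S, a, ha⟩ := h2 E hE n hn hcpt π hπ hreg ℓ ι
    obtain ⟨𝒰, i, hS, hlim⟩ := h3 E hE n hn hcpt π hπ hreg ℓ ι S a ha
    exact ⟨𝒰, i, a, occurs_of_congruences E n ℓ 𝒰 i a hlim, fun v hv => ha v fun hvS => hv (hS v hvS)⟩

/-- **Four-piece seam** (both axes; the stubs of `Lines/integral_family_split.lean`):
`IntegralFamilyRegular → OccursOfFamilyRegular → IntegralFamilyIrregular → OccursOfFamilyIrregular →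
Visibility`. -/
theorem Visibility_of_four :
    IntegralFamilyRegular → OccursOfFamilyRegular → IntegralFamilyIrregular → OccursOfFamilyIrregular →
      Summit.Langlands.Langlands.Theses.CMFreeCompletedClosure.Visibility := by
  intro h1 h2 h3 h4 E _ _ hE n hn hcpt π hπ ℓ _ ι
  by_cases hreg : (∃ T : Literature.NumberTheory.Automorphic.InfinityType E n, π.1.HasInfinityType T ∧ T.IsLAlgebraic ∧ T.IsRegular)
  · obtain ⟨S, a, ha⟩ := h1 E hE n hn hcpt π hπ hreg ℓ ι
    obtain ⟨𝒰, i, hS, hocc⟩ := h2 E hE n hn hcpt π hπ hreg ℓ ι S a ha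
    exact ⟨𝒰, i, a, hocc, fun v hv => ha v fun hvS => hv (hS v hvS)⟩
  · obtain ⟨S, a, ha⟩ := h3 E hE n hn hcpt π hπ hreg ℓ ι
    obtain ⟨𝒰, i, hS, hlim⟩ := h4 E hE n hn hcpt π hπ hreg ℓ ι S a ha
    exact ⟨𝒰, i, a, occurs_of_congruences E n ℓ 𝒰 i a hlim, fun v hv => ha v fun hvS => hv (hS v hvS)⟩

/-- `VisibilityRegular` from the two regular-sector pieces (so the four-piece seam refines the
two-axis one). -/
theorem visibilityRegular_of : IntegralFamilyRegular → OccursOfFamilyRegular → VisibilityRegular := by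
  intro h1 h2 E _ _ hE n hn hcpt π hπ hreg ℓ _ ι
  obtain ⟨S, a, ha⟩ := h1 E hE n hn hcpt π hπ hreg ℓ ι
  obtain ⟨𝒰, i, hS, hocc⟩ := h2 E hE n hn hcpt π hπ hreg ℓ ι S a ha
  exact ⟨𝒰, i, a, hocc, fun v hv => ha v fun hvS => hv (hS v hvS)⟩

/-- `IrregularLimit` from the two irregular-sector pieces. -/
theorem irregularLimit_of : IntegralFamilyIrregular → OccursOfFamilyIrregular → IrregularLimit := by
  intro h1 h2 E _ _ hE n hn hcpt π hπ hreg ℓ _ ι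
  obtain ⟨S, a, ha⟩ := h1 E hE n hn hcpt π hπ hreg ℓ ι
  obtain ⟨𝒰, i, hS, hlim⟩ := h2 E hE n hn hcpt π hπ hreg ℓ ι S a ha
  exact ⟨𝒰, i, a, fun v hv => ha v fun hvS => hv (hS v hvS), hlim⟩

end Summit.Langlands.Langlands.Cruxes.Visibility.StrategySplit
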